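import Summits.Ventures.Crystal3D.Theorems.StickyWulffConstantTextureLiminfBarlowSampleBonds
import Summits.Ventures.Crystal3D.Theorems.StickyWulffConstantGenericWallFloorCredits
import Summits.Ventures.Crystal3D.Theorems.StickyWulffConstantNoReconstructionGainLatticeAdhesion
import Summits.Ventures.Crystal3D.Theorems.StickyWulffConstantTextureLiminfTexShadowWallDefs
import HarnessLib

/-!
# TB-1 (tiling identity, TB-C core): the HALF-DEFECT measure of a packing and the domination of a wall cell's budget by it
# (lane T, crux `TextureLiminfV5`, stmt-Ventures-23912; `stub_textureBuild` → TB-0.md §2 TB-C; cf-p1 DECISION (cxiii) «TB-1 GO», 2026-08-29T05:13:29Z)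

HONEST FRAMING. Venture `Summits/Ventures/Crystal3D` (cell `crystal3d-full`), route `route-Ventures-StickyWulffConstant`, helper `--supports` the
law-v5 crux `TextureLiminfV5` (stmt-Ventures-23912).  Pure finite combinatorics of contact graphs (census-free, standard axioms); nothing about any wall law
or any texture is claimed; rung F-C1 not moved.

THE CURRENCY.  For a finite packing `X'` (pairwise distances `≥ 1`) and a point `a`, the HALF-DEFECT `halfDefect X' a := (12 − #{q ∈ X' : |a − q| = 1})/2` is
nonnegative (kissing number, `card_filter_dist_eq_one_le_twelve`) and sums to the deficiency: `contactDeficiency X' = Σ_{a ∈ X'} halfDefect X' a`.  Every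
certificate of the texture build (tent, wall cell, crust cell) is charged against the half-defects of ITS OWN balls; since the pieces of the cover are disjoint,
the budgets add up to at most `Def(X') = 6N' − C(x')` plus RIM terms (bonds leaving a piece) — the tiling identity of TB-0.md §2 TB-C.  This file proves the
engine and the WALL-CELL line:
* `contactDeficiency_eq_sum_halfDefect`, `sum_halfDefect_le_contactDeficiency` (drop nonnegative terms);
* `contactDeficiency_eq_sum_halfDefect_add_cross` — for `A ⊆ X'`: `D(A) = Σ_{a∈A} halfDefect X' a + ½·cross(A, X' ∖ A)` (a sub-piece's own deficiency
  over-counts exactly half its outgoing bonds);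
* `sum_contactDeficiency_le_of_pairwiseDisjoint` — for pairwise disjoint pieces `A_i ⊆ X'`: `Σ_i D(A_i) ≤ D(X') + ½·Σ_i cross(A_i, X' ∖ A_i)`;
* `innerBonds_le_sum` — THE PLATE LINE: for a plate `P ⊆ S` (a moved Barlow stacking, twelve sites per point) none of whose balls lies `beyond` its own
  inner face, `innerBonds S P beyond ≤ Σ_{p∈P} (12 − cdeg X' p) + #{(p,q) ∈ P × X' : |p−q| = 1, q ∉ S ∨ beyond q}` (the inner-face site count is paid by
  the plate balls' own defects plus their bonds to filling-like balls — off-lattice or beyond the face);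
* **`wallBudget_le_sum_halfDefect`** — THE WALL-CELL LINE: for a cell `X_k ⊆ X'` with disjoint plates `P₁ ⊆ S₁`, `P₂ ⊆ S₂` (not beyond their faces, no
  plate–plate bond) and filling `F = X_k ∖ (P₁ ∪ P₂)`:
  `D(F) + ½·iB₁ + ½·iB₂ − cross(P₁, X_k ∖ P₁) − cross(P₂, F) ≤ Σ_{a ∈ X_k} halfDefect X' a + ½·cross(F, X'∖X_k) + ½·rim₁ + ½·rim₂`,
  `rim_i := #{(p,q) ∈ P_i × (X'∖X_k) : |p−q| = 1, q ∉ S_i ∨ beyond_i q}` — EXACTLY the budget (RHS − LHS without charge and `C(1+h)ρ`) of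
  `BilayerWallAt`, so `WallCell.budget ≤ Σ halfDefect + rims` for the cells of TB-0's `CellCover` (the outer faces of the plates are NOT rim terms: their
  partners lie on `S_i` and not beyond).
The tent line (`brokenNearIn ≤ Σ halfDefect + …`) is the sequel file.
WHAT THIS IS NOT: no texture, no cover, no cell inequality; F-C1 not moved.
-/

noncomputable section

namespace Summit.Ventures.Crystal3D.Theorems

open Finset Summit.Ventures.Crystal3D
open Literature.MathematicalPhysics.StatisticalMechanics (IsHaggSeq orderedContacts contactDeficiency)
open Summit.Ventures.Crystal3D.Cruxes.TextureLiminf.TexShadow (E3 stacking innerBonds)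
open Summit.Ventures.Crystal3D.TentCertificate (finite_touching)

/-! ## Contact degree, half-defect, cross counts -/

/-- contact degree of the point `a` in the finite configuration `X`: `#{q ∈ X : |a − q| = 1}`. -/
def cdeg (X : Finset E3) (a : E3) : ℕ := (X.filter fun q => dist a q = 1).card

/-- the HALF-DEFECT of `a` in `X`: `(12 − cdeg X a)/2`. -/
def halfDefect (X : Finset E3) (a : E3) : ℝ := ((12 : ℝ) - (cdeg X a : ℝ)) / 2

/-- number of ordered contact pairs `(a, b) ∈ A × B` (`|a − b| = 1`). -/
def crossCount (A B : Finset E3) : ℕ := ((A ×ˢ B).filter fun pq => dist pq.1 pq.2 = 1).card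

/-- Kissing bound: `cdeg X' a ≤ 12` in a packing. -/
theorem cdeg_le_twelve (X' : Finset E3) (hX : ∀ p ∈ X', ∀ q ∈ X', p ≠ q → 1 ≤ dist p q) (a : E3) : cdeg X' a ≤ 12 :=
  card_filter_dist_eq_one_le_twelve X' hX a

/-- Half-defects are nonnegative in a packing. -/
theorem halfDefect_nonneg (X' : Finset E3) (hX : ∀ p ∈ X', ∀ q ∈ X', p ≠ q → 1 ≤ dist p q) (a : E3) : 0 ≤ halfDefect X' a := by
  have h := cdeg_le_twelve X' hX a
  have h' : (cdeg X' a : ℝ) ≤ 12 := by exact_mod_cast h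
  unfold halfDefect
  linarith

/-- **`D(X) = Σ_{a∈X} halfDefect X a`.** -/
theorem contactDeficiency_eq_sum_halfDefect (X : Finset E3) : contactDeficiency X = ∑ a ∈ X, halfDefect X a := by
  have h := two_mul_contactDeficiency_eq_sum X
  unfold halfDefect cdeg
  rw [← Finset.sum_div]
  linarith

/-- Dropping nonnegative terms: `Σ_{a∈A} halfDefect X' a ≤ D(X')` for `A ⊆ X'`. -/
theorem sum_halfDefect_le_contactDeficiency (X' : Finset E3) (hX : ∀ p ∈ X', ∀ q ∈ X', p ≠ q → 1 ≤ dist p q)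
    {A : Finset E3} (hA : A ⊆ X') : ∑ a ∈ A, halfDefect X' a ≤ contactDeficiency X' := by
  rw [contactDeficiency_eq_sum_halfDefect]
  exact Finset.sum_le_sum_of_subset_of_nonneg hA fun a _ _ => halfDefect_nonneg X' hX a

/-- The degree in `X'` splits along `A ⊆ X'`: `cdeg X' a = cdeg A a + #{q ∈ X' ∖ A : |a−q| = 1}`. -/
theorem cdeg_eq_add_sdiff {A X' : Finset E3} (hA : A ⊆ X') (a : E3) :
    cdeg X' a = cdeg A a + ((X' \ A).filter fun q => dist a q = 1).card := by
  classical
  unfold cdeg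
  rw [← Finset.card_union_of_disjoint (Finset.disjoint_filter_filter Finset.disjoint_sdiff), ← Finset.filter_union,
    Finset.union_sdiff_of_subset hA]

/-- `crossCount A B = Σ_{a ∈ A} #{q ∈ B : |a − q| = 1}`. -/
theorem crossCount_eq_sum (A B : Finset E3) : crossCount A B = ∑ a ∈ A, (B.filter fun q => dist a q = 1).card := by
  classical
  unfold crossCount
  rw [Finset.card_filter, Finset.sum_product]
  refine Finset.sum_congr rfl fun a _ => ?_
  rw [Finset.card_filter]

/-- `crossCount` is monotone in the second argument. -/
theorem crossCount_mono_right (A : Finset E3) {B B' : Finset E3} (h : B ⊆ B') : crossCount A B ≤ crossCount A B' := by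
  classical
  unfold crossCount
  exact Finset.card_le_card (Finset.filter_subset_filter _ (Finset.product_subset_product_right h))

/-- `crossCount` splits over a disjoint union in the second argument. -/
theorem crossCount_union_right (A : Finset E3) {B C : Finset E3} (h : Disjoint B C) :
    crossCount A (B ∪ C) = crossCount A B + crossCount A C := by
  classical
  unfold crossCount
  rw [Finset.product_union, Finset.filter_union,
    Finset.card_union_of_disjoint (Finset.disjoint_filter_filter (Finset.disjoint_product.mpr (Or.inr h)))]

/-- `crossCount` splits over a disjoint union in the first argument. -/
theorem crossCount_union_left {A B : Finset E3} (h : Disjoint A B) (C : Finset E3) :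
    crossCount (A ∪ B) C = crossCount A C + crossCount B C := by
  classical
  unfold crossCount
  rw [Finset.union_product, Finset.filter_union,
    Finset.card_union_of_disjoint (Finset.disjoint_filter_filter (Finset.disjoint_product.mpr (Or.inl h)))]

/-- `crossCount` is symmetric. -/
theorem crossCount_comm (A B : Finset E3) : crossCount A B = crossCount B A := by
  classical
  unfold crossCount
  refine Finset.card_bij (fun pq _ => (pq.2, pq.1)) ?_ ?_ ?_
  · intro pq hpq
    simp only [Finset.mem_filter, Finset.mem_product] at hpq ⊢
    exact ⟨⟨hpq.1.2, hpq.1.1⟩, by rw [dist_comm]; exact hpq.2⟩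
  · intro pq _ pq' _ h
    simp only [Prod.mk.injEq] at h
    exact Prod.ext h.2 h.1
  · intro pq hpq
    refine ⟨(pq.2, pq.1), ?_, rfl⟩
    simp only [Finset.mem_filter, Finset.mem_product] at hpq ⊢
    exact ⟨⟨hpq.1.2, hpq.1.1⟩, by rw [dist_comm]; exact hpq.2⟩

/-- **A sub-piece's deficiency in half-defect currency**: for `A ⊆ X'`, `D(A) = Σ_{a∈A} halfDefect X' a + ½·crossCount A (X' ∖ A)`. -/
theorem contactDeficiency_eq_sum_halfDefect_add_cross {A X' : Finset E3} (hA : A ⊆ X') :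
    contactDeficiency A = ∑ a ∈ A, halfDefect X' a + (crossCount A (X' \ A) : ℝ) / 2 := by
  rw [contactDeficiency_eq_sum_halfDefect, crossCount_eq_sum, Nat.cast_sum, Finset.sum_div, ← Finset.sum_add_distrib]
  refine Finset.sum_congr rfl fun a _ => ?_
  unfold halfDefect
  rw [cdeg_eq_add_sdiff hA a]
  push_cast
  ring

/-- **Disjoint pieces**: for pairwise disjoint `A_i ⊆ X'` (`i ∈ T`) in a packing,
`Σ_i D(A_i) ≤ D(X') + ½·Σ_i crossCount (A_i) (X' ∖ A_i)`. -/
theorem sum_contactDeficiency_le_of_pairwiseDisjoint {ι : Type*} (T : Finset ι) (A : ι → Finset E3) (X' : Finset E3)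
    (hX : ∀ p ∈ X', ∀ q ∈ X', p ≠ q → 1 ≤ dist p q) (hA : ∀ i ∈ T, A i ⊆ X')
    (hdisj : ∀ i ∈ T, ∀ j ∈ T, i ≠ j → Disjoint (A i) (A j)) :
    ∑ i ∈ T, contactDeficiency (A i) ≤ contactDeficiency X' + ∑ i ∈ T, (crossCount (A i) (X' \ A i) : ℝ) / 2 := by
  classical
  have hrew : ∑ i ∈ T, contactDeficiency (A i) =
      ∑ i ∈ T, ∑ a ∈ A i, halfDefect X' a + ∑ i ∈ T, (crossCount (A i) (X' \ A i) : ℝ) / 2 := by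
    rw [← Finset.sum_add_distrib]
    exact Finset.sum_congr rfl fun i hi => contactDeficiency_eq_sum_halfDefect_add_cross (hA i hi)
  rw [hrew, ← Finset.sum_biUnion hdisj]
  have hsub : T.biUnion A ⊆ X' := Finset.biUnion_subset.2 hA
  linarith [sum_halfDefect_le_contactDeficiency X' hX hsub]

/-! ## The plate line: inner-face bonds against the plate balls' own defects -/

open scoped Classical in
/-- At a plate ball `p ∈ P ⊆ S`: the `beyond`-sites of `S` adjacent to `p` and the balls of `X'` adjacent to `p` that sit on NON-beyond sites of `S`
are disjoint subsets of the twelve sites, so `#beyond-sites(p) + #{q ∈ X' adj p : q ∈ S, ¬beyond q} ≤ 12`. -/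
theorem ncard_beyond_add_card_onLattice_le_twelve {L : E3 ≃ₗᵢ[ℝ] E3} {s : E3} {σ : ℤ → ℤ} (hσ : IsHaggSeq σ)
    (beyond : E3 → Prop) {p : E3} (hp : p ∈ stacking L s σ) (X' : Finset E3) :
    ({q : E3 | q ∈ stacking L s σ ∧ dist p q = 1 ∧ beyond q}.ncard : ℝ) +
      ((X'.filter fun q => dist p q = 1 ∧ q ∈ stacking L s σ ∧ ¬ beyond q).card : ℝ) ≤ 12 := by
  classical
  have hfin := finite_touching hσ hp
  have h12 := ncard_touching_stacking_eq_twelve hσ hp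
  set B : Set E3 := {q : E3 | q ∈ stacking L s σ ∧ dist p q = 1 ∧ beyond q} with hB
  set O : Finset E3 := X'.filter fun q => dist p q = 1 ∧ q ∈ stacking L s σ ∧ ¬ beyond q with hO
  have hBsub : B ⊆ {y | y ∈ stacking L s σ ∧ dist p y = 1} := fun q hq => ⟨hq.1, hq.2.1⟩
  have hOsub : (↑O : Set E3) ⊆ {y | y ∈ stacking L s σ ∧ dist p y = 1} := by
    intro q hq
    have hq' := (Finset.mem_filter.1 (Finset.mem_coe.1 hq)).2
    exact ⟨hq'.2.1, hq'.1⟩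
  have hdisj : Disjoint B (↑O : Set E3) := by
    rw [Set.disjoint_left]
    intro q hqB hqO
    exact (Finset.mem_filter.1 (Finset.mem_coe.1 hqO)).2.2.2 hqB.2.2
  have hunion : (B ∪ ↑O).ncard ≤ 12 := by
    rw [← h12]; exact Set.ncard_le_ncard (Set.union_subset hBsub hOsub) hfin
  have hBfin : B.Finite := hfin.subset hBsub
  rw [Set.ncard_union_eq hdisj hBfin O.finite_toSet, Set.ncard_coe_finset] at hunion
  exact_mod_cast hunion

open scoped Classical in
/-- **The plate line.**  For a plate `P ⊆ S` none of whose balls is `beyond` its own inner face, in a configuration `X' ⊇ P`: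
`innerBonds S P beyond ≤ Σ_{p∈P} (12 − cdeg X' p) + #{(p, q) ∈ P × X' : |p − q| = 1, q ∉ S ∨ beyond q}`. -/
theorem innerBonds_le_sum {L : E3 ≃ₗᵢ[ℝ] E3} {s : E3} {σ : ℤ → ℤ} (hσ : IsHaggSeq σ) (beyond : E3 → Prop)
    {P X' : Finset E3} (hPS : (↑P : Set E3) ⊆ stacking L s σ) :
    innerBonds (stacking L s σ) P beyond ≤
      ∑ p ∈ P, ((12 : ℝ) - (cdeg X' p : ℝ)) +
        (((P ×ˢ X').filter fun pq : E3 × E3 => dist pq.1 pq.2 = 1 ∧ (pq.2 ∉ stacking L s σ ∨ beyond pq.2)).card : ℝ) := by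
  classical
  -- the second term as a sum over `p ∈ P`
  have hsum : (((P ×ˢ X').filter fun pq : E3 × E3 => dist pq.1 pq.2 = 1 ∧ (pq.2 ∉ stacking L s σ ∨ beyond pq.2)).card : ℝ) =
      ∑ p ∈ P, ((X'.filter fun q => dist p q = 1 ∧ (q ∉ stacking L s σ ∨ beyond q)).card : ℝ) := by
    rw [Finset.card_filter, Finset.sum_product, Nat.cast_sum]
    refine Finset.sum_congr rfl fun p _ => ?_
    rw [Finset.card_filter, Nat.cast_sum]
  rw [hsum, ← Finset.sum_add_distrib]
  unfold innerBonds
  refine Finset.sum_le_sum fun p hp => ?_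
  -- split the `X'`-neighbours of `p` into on-lattice-non-beyond ones and the rest
  have hset : (X'.filter fun q => dist p q = 1) =
      (X'.filter fun q => dist p q = 1 ∧ q ∈ stacking L s σ ∧ ¬ beyond q) ∪
        (X'.filter fun q => dist p q = 1 ∧ (q ∉ stacking L s σ ∨ beyond q)) := by
    ext q
    simp only [Finset.mem_filter, Finset.mem_union]
    constructor
    · intro ⟨hq, hd⟩
      by_cases hS : q ∈ stacking L s σ
      · by_cases hb : beyond q
        · exact Or.inr ⟨hq, hd, Or.inr hb⟩
        · exact Or.inl ⟨hq, hd, hS, hb⟩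
      · exact Or.inr ⟨hq, hd, Or.inl hS⟩
    · rintro (⟨hq, hd, -⟩ | ⟨hq, hd, -⟩) <;> exact ⟨hq, hd⟩
  have hdj : Disjoint (X'.filter fun q => dist p q = 1 ∧ q ∈ stacking L s σ ∧ ¬ beyond q)
      (X'.filter fun q => dist p q = 1 ∧ (q ∉ stacking L s σ ∨ beyond q)) := by
    rw [Finset.disjoint_filter]
    intro q _ h1 h2
    rcases h2.2 with h | h
    · exact h h1.2.1
    · exact h1.2.2 h
  have hsplit : (cdeg X' p : ℝ) = ((X'.filter fun q => dist p q = 1 ∧ q ∈ stacking L s σ ∧ ¬ beyond q).card : ℝ) +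
      ((X'.filter fun q => dist p q = 1 ∧ (q ∉ stacking L s σ ∨ beyond q)).card : ℝ) := by
    unfold cdeg
    rw [hset, Finset.card_union_of_disjoint hdj, Nat.cast_add]
  have h12 := ncard_beyond_add_card_onLattice_le_twelve hσ beyond (hPS hp) X'
  rw [hsplit]
  linarith

/-! ## The wall-cell line -/

open scoped Classical in
/-- **THE WALL-CELL BUDGET IS DOMINATED BY THE CELL'S OWN HALF-DEFECTS PLUS RIM TERMS.**  Let `X' ⊇ X_k` be a finite configuration (no packing hypothesis is needed here), `P₁, P₂ ⊆ X_k` disjoint plates on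
moved Barlow stackings `S₁, S₂`, no plate ball beyond its own inner face, no plate–plate contact, `F := (X_k ∖ P₁) ∖ P₂` the filling.  Then
`D(F) + ½ iB₁ + ½ iB₂ − cross(P₁, X_k∖P₁) − cross(P₂, F) ≤ Σ_{a∈X_k} halfDefect X' a + ½ crossCount F (X'∖X_k) + ½ rim₁ + ½ rim₂` with
`rim_i := #{(p,q) ∈ P_i × (X'∖X_k) : |p−q| = 1, q ∉ S_i ∨ beyond_i q}` (plate bonds to filling-LIKE balls outside the cell; outer-face partners, being on `S_i`
and not beyond, are excluded). -/
theorem wallBudget_le_sum_halfDefect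
    {L₁ L₂ : E3 ≃ₗᵢ[ℝ] E3} {s₁ s₂ : E3} {σ₁ σ₂ : ℤ → ℤ} (hσ₁ : IsHaggSeq σ₁) (hσ₂ : IsHaggSeq σ₂)
    (beyond₁ beyond₂ : E3 → Prop) {X' Xk P₁ P₂ : Finset E3}
    (hXk : Xk ⊆ X') (hP₁ : P₁ ⊆ Xk) (hP₂ : P₂ ⊆ Xk \ P₁)
    (hS₁ : (↑P₁ : Set E3) ⊆ stacking L₁ s₁ σ₁) (hS₂ : (↑P₂ : Set E3) ⊆ stacking L₂ s₂ σ₂)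
    (hnb₁ : ∀ p ∈ P₁, ¬ beyond₁ p) (hnb₂ : ∀ p ∈ P₂, ¬ beyond₂ p)
    (hfar : ∀ p ∈ P₁, ∀ q ∈ P₂, dist p q ≠ 1) :
    contactDeficiency ((Xk \ P₁) \ P₂) +
        1 / 2 * innerBonds (stacking L₁ s₁ σ₁) P₁ beyond₁ + 1 / 2 * innerBonds (stacking L₂ s₂ σ₂) P₂ beyond₂ -
        (crossCount P₁ (Xk \ P₁) : ℝ) - (crossCount P₂ ((Xk \ P₁) \ P₂) : ℝ) ≤
      ∑ a ∈ Xk, halfDefect X' a + (crossCount ((Xk \ P₁) \ P₂) (X' \ Xk) : ℝ) / 2 +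
        (((P₁ ×ˢ (X' \ Xk)).filter fun pq : E3 × E3 => dist pq.1 pq.2 = 1 ∧ (pq.2 ∉ stacking L₁ s₁ σ₁ ∨ beyond₁ pq.2)).card : ℝ) / 2 +
        (((P₂ ×ˢ (X' \ Xk)).filter fun pq : E3 × E3 => dist pq.1 pq.2 = 1 ∧ (pq.2 ∉ stacking L₂ s₂ σ₂ ∨ beyond₂ pq.2)).card : ℝ) / 2 := by
  classical
  set F : Finset E3 := (Xk \ P₁) \ P₂ with hF
  have hP₂Xk : P₂ ⊆ Xk := fun q hq => (Finset.mem_sdiff.1 (hP₂ hq)).1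
  have hFX' : F ⊆ X' := fun a ha => hXk (Finset.mem_sdiff.1 (Finset.mem_sdiff.1 ha).1).1
  have hdisj₁₂ : Disjoint P₁ P₂ := by
    rw [Finset.disjoint_left]; intro q hq₁ hq₂; exact (Finset.mem_sdiff.1 (hP₂ hq₂)).2 hq₁
  have hdisjF₁ : Disjoint F P₁ := by
    rw [Finset.disjoint_left]; intro q hqF hq₁
    exact (Finset.mem_sdiff.1 (Finset.mem_sdiff.1 hqF).1).2 hq₁
  have hdisjF₂ : Disjoint F P₂ := by
    rw [Finset.disjoint_left]; intro q hqF hq₂; exact (Finset.mem_sdiff.1 hqF).2 hq₂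
  -- the pieces of `X' ∖ F`: `P₁`, `P₂`, `X' ∖ Xk`
  have hXF : X' \ F = P₁ ∪ P₂ ∪ (X' \ Xk) := by
    ext q
    simp only [hF, Finset.mem_sdiff, Finset.mem_union]
    constructor
    · rintro ⟨hqX, hnot⟩
      by_cases hq1 : q ∈ P₁
      · exact Or.inl (Or.inl hq1)
      by_cases hq2 : q ∈ P₂
      · exact Or.inl (Or.inr hq2)
      by_cases hqk : q ∈ Xk
      · exact absurd ⟨⟨hqk, hq1⟩, hq2⟩ hnot
      · exact Or.inr ⟨hqX, hqk⟩
    · rintro ((hq1 | hq2) | ⟨hqX, hqk⟩)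
      · exact ⟨hXk (hP₁ hq1), fun h => h.1.2 hq1⟩
      · exact ⟨hXk (hP₂Xk hq2), fun h => h.2 hq2⟩
      · exact ⟨hqX, fun h => hqk h.1.1⟩
  have hdisjU : Disjoint (P₁ ∪ P₂) (X' \ Xk) := by
    rw [Finset.disjoint_left]; intro q hq hq'
    rcases Finset.mem_union.1 hq with h | h
    · exact (Finset.mem_sdiff.1 hq').2 (hP₁ h)
    · exact (Finset.mem_sdiff.1 hq').2 (hP₂Xk h)
  -- D(F) in half-defect currency
  have hDF : contactDeficiency F = ∑ a ∈ F, halfDefect X' a +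
      ((crossCount F P₁ : ℝ) + (crossCount F P₂ : ℝ) + (crossCount F (X' \ Xk) : ℝ)) / 2 := by
    rw [contactDeficiency_eq_sum_halfDefect_add_cross hFX', hXF, crossCount_union_right F hdisjU,
      crossCount_union_right F hdisj₁₂]
    push_cast; ring
  -- the plate lines
  have hIB₁ := innerBonds_le_sum hσ₁ beyond₁ (X' := X') hS₁
  have hIB₂ := innerBonds_le_sum hσ₂ beyond₂ (X' := X') hS₂
  -- the filling-like neighbours of plate 1 inside `X'` are in `F` or outside the cell
  have hrim₁ : (((P₁ ×ˢ X').filter fun pq : E3 × E3 => dist pq.1 pq.2 = 1 ∧ (pq.2 ∉ stacking L₁ s₁ σ₁ ∨ beyond₁ pq.2)).card : ℝ) ≤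
      (crossCount P₁ F : ℝ) +
        (((P₁ ×ˢ (X' \ Xk)).filter fun pq : E3 × E3 => dist pq.1 pq.2 = 1 ∧ (pq.2 ∉ stacking L₁ s₁ σ₁ ∨ beyond₁ pq.2)).card : ℝ) := by
    rw [← Nat.cast_add]
    refine Nat.cast_le.mpr (le_trans (Finset.card_le_card ?_) (Finset.card_union_le _ _))
    intro pq hpq
    simp only [Finset.mem_filter, Finset.mem_product, Finset.mem_union] at hpq ⊢
    obtain ⟨⟨hp, hq⟩, hd, hor⟩ := hpq
    by_cases hqk : pq.2 ∈ Xk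
    · -- inside the cell: not a plate-1 ball (on lattice, not beyond), not a plate-2 ball (no plate–plate bond)
      left
      refine ⟨⟨hp, ?_⟩, hd⟩
      rw [hF, Finset.mem_sdiff, Finset.mem_sdiff]
      refine ⟨⟨hqk, fun hq1 => ?_⟩, fun hq2 => hfar _ hp _ hq2 hd⟩
      rcases hor with h | h
      · exact h (hS₁ hq1)
      · exact hnb₁ _ hq1 h
    · right
      exact ⟨⟨hp, Finset.mem_sdiff.2 ⟨hq, hqk⟩⟩, hd, hor⟩
  have hrim₂ : (((P₂ ×ˢ X').filter fun pq : E3 × E3 => dist pq.1 pq.2 = 1 ∧ (pq.2 ∉ stacking L₂ s₂ σ₂ ∨ beyond₂ pq.2)).card : ℝ) ≤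
      (crossCount P₂ F : ℝ) +
        (((P₂ ×ˢ (X' \ Xk)).filter fun pq : E3 × E3 => dist pq.1 pq.2 = 1 ∧ (pq.2 ∉ stacking L₂ s₂ σ₂ ∨ beyond₂ pq.2)).card : ℝ) := by
    rw [← Nat.cast_add]
    refine Nat.cast_le.mpr (le_trans (Finset.card_le_card ?_) (Finset.card_union_le _ _))
    intro pq hpq
    simp only [Finset.mem_filter, Finset.mem_product, Finset.mem_union] at hpq ⊢
    obtain ⟨⟨hp, hq⟩, hd, hor⟩ := hpq
    by_cases hqk : pq.2 ∈ Xk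
    · left
      refine ⟨⟨hp, ?_⟩, hd⟩
      rw [hF, Finset.mem_sdiff, Finset.mem_sdiff]
      refine ⟨⟨hqk, fun hq1 => hfar _ hq1 _ hp (by rw [dist_comm]; exact hd)⟩, fun hq2 => ?_⟩
      rcases hor with h | h
      · exact h (hS₂ hq2)
      · exact hnb₂ _ hq2 h
    · right
      exact ⟨⟨hp, Finset.mem_sdiff.2 ⟨hq, hqk⟩⟩, hd, hor⟩
  -- half-defects of the plates
  have hhd₁ : ∑ p ∈ P₁, ((12 : ℝ) - (cdeg X' p : ℝ)) = 2 * ∑ p ∈ P₁, halfDefect X' p := by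
    rw [Finset.mul_sum]; refine Finset.sum_congr rfl fun p _ => ?_; unfold halfDefect; ring
  have hhd₂ : ∑ p ∈ P₂, ((12 : ℝ) - (cdeg X' p : ℝ)) = 2 * ∑ p ∈ P₂, halfDefect X' p := by
    rw [Finset.mul_sum]; refine Finset.sum_congr rfl fun p _ => ?_; unfold halfDefect; ring
  -- the cross terms of the budget
  have hc₁ : (crossCount P₁ F : ℝ) ≤ (crossCount P₁ (Xk \ P₁) : ℝ) := by
    exact_mod_cast crossCount_mono_right P₁ (Finset.sdiff_subset)
  have hcF₁ : crossCount F P₁ = crossCount P₁ F := crossCount_comm F P₁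
  have hcF₂ : crossCount F P₂ = crossCount P₂ F := crossCount_comm F P₂
  -- the half-defect sum over the cell splits over `F ∪ P₁ ∪ P₂`
  have hXk_eq : Xk = F ∪ P₁ ∪ P₂ := by
    ext q
    simp only [hF, Finset.mem_union, Finset.mem_sdiff]
    constructor
    · intro hq
      by_cases h1 : q ∈ P₁
      · exact Or.inl (Or.inr h1)
      · by_cases h2 : q ∈ P₂
        · exact Or.inr h2
        · exact Or.inl (Or.inl ⟨⟨hq, h1⟩, h2⟩)
    · rintro ((⟨⟨hq, -⟩, -⟩ | h1) | h2)
      · exact hq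
      · exact hP₁ h1
      · exact hP₂Xk h2
  have hsumXk : ∑ a ∈ Xk, halfDefect X' a = ∑ a ∈ F, halfDefect X' a + ∑ a ∈ P₁, halfDefect X' a + ∑ a ∈ P₂, halfDefect X' a := by
    rw [hXk_eq, Finset.sum_union, Finset.sum_union hdisjF₁]
    rw [Finset.disjoint_union_left]; exact ⟨hdisjF₂, hdisj₁₂⟩
  rw [hDF, hsumXk, hcF₁, hcF₂]
  linarith [hIB₁, hIB₂, hrim₁, hrim₂, hhd₁, hhd₂, hc₁]

end Summit.Ventures.Crystal3D.Theorems

end
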